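import Literature.Combinatorics.Additive.TripleProductPropertySAT
import Summits.MatrixMultiplication.OmegaCensus.DihedralLikeTiling
import HarnessLib

/-!
# The eight vertex counting constraints of a TPP triple in a dihedral-like group

ω-census, family (b3).  Framing: lottery ticket; floor = certified bounds/negative ranges.

Setting of `DihedralLikeTPPBound.lean` / `DihedralLikeTiling.lean`: a group `G` with a dihedral-like presentation
`ρ, τ : A → G` over a finite abelian group `A` (`ρ a ρ b = ρ(a+b)`, `ρ a τ b = τ(b−a)`, `τ a ρ b = τ(a+b)`,
`τ a τ b = ρ(c₀ + b − a)`), a TPP triple `(S, T, U)` of `G`, coset parts `X₀ = {a : ρ a ∈ X}`, `X₁ = {a : τ a ∈ X}`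
and box products `p_{ijk} = |S_i| |T_j| |U_k|` (`i, j, k ∈ {0,1}`).  The counting argument of the census so far
(`parts_counting'`) uses four constraints: `p₀₀₀ ≤ |A|`, `p₁₁₁ ≤ |A|` and the two *triangle* constraints
`p₁₀₀ + p₀₁₀ + p₀₀₁ ≤ |A|`, `p₀₁₁ + p₁₀₁ + p₁₁₀ ≤ |A|`.

**New here (`vertex_counting'`).** For *every* vertex `m` of the cube `{0,1}³` the three boxes adjacent to `m` satisfy
`∑_{e ∼ m} p_e ≤ |A|` — eight constraints, the two triangles being the vertices `m = 000` and `m = 111`.  Proof: the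
triple product property is invariant under right translation of any one of the three sets (tree lemma
`TripleProductProperty.map_mulRight`, Hedtke–Murthy 2012 Lemma 2.9), and right translation of `X` by `τ 0` swaps the
two coset parts of `X` up to the bijections `a ↦ −c₀ − a`, `a ↦ −a` of `A` (`card_rho_part_mulRight_tau`,
`card_tau_part_mulRight_tau`); applying `parts_counting'` to `(S·τ0, T, U)`, `(S, T·τ0, U)`, `(S, T, U·τ0)` gives the
six new vertices.  Summing the eight constraints gives `3|S||T||U| ≤ 8|A|` at once (each box lies at three
vertices), and the finer arithmetic of the eight constraints (`VertexCountingCore.lean`) yields the *law gap*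
`|S||T||U| ∈ {law} ∪ [0, law − 4]` for `|A| ≡ 2 (mod 3)` (`DihedralLikeLawGap.lean`).
-/

namespace Summit.MatrixMultiplication.OmegaCensus

open Literature.Combinatorics.Additive Finset

section DihedralLike

variable {A : Type*} [AddCommGroup A] [DecidableEq A] [Fintype A] {G : Type} [Group G] [DecidableEq G]
  {ρ τ : A → G} {c₀ : A}

/-- Right translation by `τ 0` turns the `ρ`-part of `X` into (a translate of) the `τ`-part:
`ρ a ∈ X·τ0 ↔ τ(−c₀ − a) ∈ X`, so the two parts have the same cardinality. [folklore] -/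
theorem card_rho_part_mulRight_tau (hρρ : ∀ a b, ρ a * ρ b = ρ (a + b)) (hρτ : ∀ a b, ρ a * τ b = τ (b - a))
    (hττ : ∀ a b, τ a * τ b = ρ (c₀ + b - a)) (X : Finset G) :
    (univ.filter fun a : A => ρ a ∈ X.map (Equiv.mulRight (τ 0)).toEmbedding).card =
      (univ.filter fun a : A => τ a ∈ X).card := by
  have hset : (univ.filter fun a : A => ρ a ∈ X.map (Equiv.mulRight (τ 0)).toEmbedding) =
      (univ.filter fun b : A => τ b ∈ X).image fun b => -c₀ - b := by
    ext a
    simp only [mem_filter, mem_univ, true_and, mem_image, Finset.mem_map_equiv, Equiv.mulRight_symm_apply]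
    rw [inv_tau hρρ hττ, hρτ, zero_sub]
    constructor
    · intro h
      exact ⟨-c₀ - a, h, by abel⟩
    · rintro ⟨b, hb, rfl⟩
      have e : -c₀ - (-c₀ - b) = b := by abel
      rwa [e]
  rw [hset, card_image_of_injective _ (sub_right_injective)]

/-- Right translation by `τ 0` turns the `τ`-part of `X` into the negative of the `ρ`-part:
`τ a ∈ X·τ0 ↔ ρ(−a) ∈ X`. [folklore] -/
theorem card_tau_part_mulRight_tau (hρρ : ∀ a b, ρ a * ρ b = ρ (a + b))
    (hττ : ∀ a b, τ a * τ b = ρ (c₀ + b - a)) (X : Finset G) :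
    (univ.filter fun a : A => τ a ∈ X.map (Equiv.mulRight (τ 0)).toEmbedding).card =
      (univ.filter fun a : A => ρ a ∈ X).card := by
  have hset : (univ.filter fun a : A => τ a ∈ X.map (Equiv.mulRight (τ 0)).toEmbedding) =
      (univ.filter fun b : A => ρ b ∈ X).image fun b => -b := by
    ext a
    simp only [mem_filter, mem_univ, true_and, mem_image, Finset.mem_map_equiv, Equiv.mulRight_symm_apply]
    rw [inv_tau hρρ hττ, hττ]
    have e : c₀ + (0 - c₀) - a = -a := by abel
    rw [e]
    constructor
    · intro h
      exact ⟨-a, h, neg_neg a⟩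
    · rintro ⟨b, hb, rfl⟩
      rwa [neg_neg]
  rw [hset, card_image_of_injective _ neg_injective]

/-- **The eight vertex constraints.** With `s₀ = |{a : ρ a ∈ S}|`, `s₁ = |{a : τ a ∈ S}|` etc. and
`p_{ijk} = s_i t_j u_k`, every TPP triple of a dihedral-like group satisfies, for each vertex `m ∈ {0,1}³`, the
inequality `∑_{e adjacent to m} p_e ≤ |A|`; listed in the order `m = 000, 111, 100, 011, 010, 101, 001, 110`.
[folklore] -/
theorem vertex_counting' (hρρ : ∀ a b, ρ a * ρ b = ρ (a + b)) (hρτ : ∀ a b, ρ a * τ b = τ (b - a))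
    (hτρ : ∀ a b, τ a * ρ b = τ (a + b)) (hττ : ∀ a b, τ a * τ b = ρ (c₀ + b - a))
    (hρ : Function.Injective ρ) (hτ : Function.Injective τ) (hne : ∀ a b, ρ a ≠ τ b)
    {S T U : Finset G} (h : TripleProductProperty S T U) :
    let s₀ := (univ.filter fun a : A => ρ a ∈ S).card
    let s₁ := (univ.filter fun a : A => τ a ∈ S).card
    let t₀ := (univ.filter fun a : A => ρ a ∈ T).card
    let t₁ := (univ.filter fun a : A => τ a ∈ T).card
    let u₀ := (univ.filter fun a : A => ρ a ∈ U).card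
    let u₁ := (univ.filter fun a : A => τ a ∈ U).card
    s₁ * t₀ * u₀ + s₀ * t₁ * u₀ + s₀ * t₀ * u₁ ≤ Fintype.card A ∧
    s₀ * t₁ * u₁ + s₁ * t₀ * u₁ + s₁ * t₁ * u₀ ≤ Fintype.card A ∧
    s₀ * t₀ * u₀ + s₁ * t₁ * u₀ + s₁ * t₀ * u₁ ≤ Fintype.card A ∧
    s₁ * t₁ * u₁ + s₀ * t₀ * u₁ + s₀ * t₁ * u₀ ≤ Fintype.card A ∧
    s₁ * t₁ * u₀ + s₀ * t₀ * u₀ + s₀ * t₁ * u₁ ≤ Fintype.card A ∧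
    s₀ * t₀ * u₁ + s₁ * t₁ * u₁ + s₁ * t₀ * u₀ ≤ Fintype.card A ∧
    s₁ * t₀ * u₁ + s₀ * t₁ * u₁ + s₀ * t₀ * u₀ ≤ Fintype.card A ∧
    s₀ * t₁ * u₀ + s₁ * t₀ * u₀ + s₁ * t₁ * u₁ ≤ Fintype.card A := by
  intro s₀ s₁ t₀ t₁ u₀ u₁
  -- the original triple: vertices 000 and 111
  obtain ⟨-, -, h000, h111⟩ := parts_counting' hρρ hρτ hτρ hττ hρ hτ hne h
  -- translate `S`: vertices 100 and 011
  obtain ⟨-, -, h100, h011⟩ := parts_counting' hρρ hρτ hτρ hττ hρ hτ hne (h.map_mulRight (τ 0) 1 1)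
  -- translate `T`: vertices 010 and 101
  obtain ⟨-, -, h010, h101⟩ := parts_counting' hρρ hρτ hτρ hττ hρ hτ hne (h.map_mulRight 1 (τ 0) 1)
  -- translate `U`: vertices 001 and 110
  obtain ⟨-, -, h001, h110⟩ := parts_counting' hρρ hρτ hτρ hττ hρ hτ hne (h.map_mulRight 1 1 (τ 0))
  have e1 : (Equiv.mulRight (1 : G)).toEmbedding = Function.Embedding.refl G := by
    ext x; simp
  simp only [e1, Finset.map_refl, card_rho_part_mulRight_tau hρρ hρτ hττ,
    card_tau_part_mulRight_tau hρρ hττ] at h100 h011 h010 h101 h001 h110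
  refine ⟨h000, h111, ?_, ?_, ?_, ?_, ?_, ?_⟩ <;> simp only [s₀, s₁, t₀, t₁, u₀, u₁] <;> linarith

/-- Summing the eight vertex constraints: `3|S||T||U| ≤ 8|A|` (each box is adjacent to three vertices) — a
one-line re-derivation of `tpp_volume_le_of_dihedralLike` without Newton's inequalities. [folklore] -/
theorem three_volume_le_of_vertex_counting
    (hρρ : ∀ a b, ρ a * ρ b = ρ (a + b)) (hρτ : ∀ a b, ρ a * τ b = τ (b - a))
    (hτρ : ∀ a b, τ a * ρ b = τ (a + b)) (hττ : ∀ a b, τ a * τ b = ρ (c₀ + b - a))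
    (hρ : Function.Injective ρ) (hτ : Function.Injective τ) (hne : ∀ a b, ρ a ≠ τ b)
    (hsurj : ∀ g, (∃ a, ρ a = g) ∨ (∃ a, τ a = g)) {S T U : Finset G} (h : TripleProductProperty S T U) :
    3 * (S.card * T.card * U.card) ≤ 8 * Fintype.card A := by
  obtain ⟨h000, h111, h100, h011, h010, h101, h001, h110⟩ := vertex_counting' hρρ hρτ hτρ hττ hρ hτ hne h
  rw [card_eq_parts' hρ hτ hne hsurj S, card_eq_parts' hρ hτ hne hsurj T, card_eq_parts' hρ hτ hne hsurj U]
  nlinarith [h000, h111, h100, h011, h010, h101, h001, h110]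

end DihedralLike

end Summit.MatrixMultiplication.OmegaCensus
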